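import Summits.Ventures.LatticeQCDFlow.Scaling.LumpedStarCollectorFloor

/-!
HONEST FRAMING: exact (Metropolis-corrected) sampling algorithms for lattice gauge theory; figures
of merit are autocorrelation/cost numbers at stated couplings and volumes; no continuum-physics
claim.

# LumpedStarCollectorSymmetric — THE `log K` FLOOR MADE LAW-FREE ON SYMMETRIC CONTENT TYPES: IF `u` LIES IN AN ORBIT `O` OF CONTENT SYMMETRIES PRESERVING `μ_0` AND `W`, THEN
# `E_{π_S}N(u) ≤ (K+1)/|O|`, SO `t_mix^{steps}(1/4) ≥ (K/(σa) − 1)·log(K|O|/(3(K+1+2|O|)))`, AND `≥ (K/(σa) − 1)·log(K/9)` AS SOON AS `|O| ≥ K+1` (lean-2 GEN-45, ours)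

Venture-side (OURS).  Cell `lqcd-flow` (pub-lqcd), unit `pub-lqcd-lean-2-g45`, 2026-08-31.  Chapter AE, file 4 — file 2's coupon-collector floor with its only law-dependent quantity,
`E_{π_S}N(u)`, bounded by symmetry instead of computed: a permutation `τ` of the contents with `μ_0∘τ = μ_0`, `W∘τ = W` induces chapter AD file 7's `π_S`-preserving bijection
`x ↦ x^τ` of the states (`comp x^τ = comp x ∘ τ`), so `E_{π_S}N(τv) = E_{π_S}N(v)`; if every `v ∈ O` is carried to `u` by such a symmetry then `|O|·E_{π_S}N(u) = Σ_{v∈O}E_{π_S}N(v) ≤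
E_{π_S}Σ_v N(v) = K+1`.

* `expect_comp_symm` (`E_π N(τv) = E_π N(v)` for every symmetric `π`), `lumpedStar_piS_expect_count_le_orbit` (`E_{π_S}N(u) ≤ (K+1)/|O|`),
  **`lumpedStar_step_mixingTime_ge_collector_orbit`** (**`t_mix^{steps}(1/4) ≥ (K/(σa) − 1)·log(K|O|/(3(K+1+2|O|)))`**),
  **`lumpedStar_step_mixingTime_ge_collector_manyContents`** (`|O| ≥ K+1` ⇒ **`t_mix^{steps}(1/4) ≥ (K/(σa) − 1)·log(K/9)`**),
  **`lumpedStar_step_mixingTime_two_floors`** (with AD7: a transitive symmetric content type with `|S| ≥ K+1` has `t_mix^{steps}(1/4) ≥ (K+1)/(8(1−σ))` AND `≥ (K/σ − 1)·log(K/9)`).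

Reading (no numerics implied): on the witness family "`q ≥ K+1` exchangeable contents" (e.g. `μ_0` uniform and `W` constant on `S` — the idealised star, every swap accepted — or any
law with a transitive symmetry group) the lumped star's step law is `Ω(K/(1−σ) + (K/σ)·log K)` from below against chapter AD file 4's `O((K/((1−σ)σp̄))·log(K/(σp̄ε)))` from above:
TWO-SIDED INCLUDING THE LOGARITHM in `K`, at fixed swap odds.  With persistence classes (`u` in an orbit of heavy contents, `a = W₂/W_u < 1`) the floor keeps the factor `1/a`.
NOT CLAIMED: the `½·log K` for two contents (there `|O| ≤ 2`).  Literature grade (cell rule): OWN, elementary on files 1–2 and AD7; nothing cited as a fact; no new bib keys.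
-/

noncomputable section

open Finset Function
open Literature.Probability.MarkovChains

namespace Summit.Ventures.LatticeQCDFlow.Scaling

section CollectorSymm
variable {X : Type*} [Fintype X] [DecidableEq X] {S : Type*} [Fintype S] [DecidableEq S]
variable {hub : X → S} {comp : X → S → ℕ} {K : ℕ} {μ0 W : S → ℝ} {σ : ℝ} {acc : S → S → ℝ} {Kh : (S → ℕ) → S → S → ℝ}
variable {Ast Bst Sst : X → X → ℝ} {g : (S → ℕ) → ℝ} {πS : X → ℝ} {Z : ℝ}

/-! ## §1 Symmetric laws give equal mean counts along an orbit -/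

omit [DecidableEq X] [DecidableEq S] in
/-- **`E_π N(τv) = E_π N(v)`** for every law `π` invariant under the state map `x ↦ x^τ` of a content permutation `τ`. [ours] -/
theorem expect_comp_symm (hinj : ∀ x x', hub x = hub x' → comp x = comp x' → x = x')
    (hsurj : ∀ (z : S) (N : S → ℕ), ∑ v, N v = K + 1 → N z ≠ 0 → ∃ x, hub x = z ∧ comp x = N) (hhub : ∀ x, comp x (hub x) ≠ 0)
    (hsum : ∀ x, ∑ v, comp x v = K + 1) (τ : S ≃ S) {π : X → ℝ} (hπτ : ∀ x y, hub y = τ.symm (hub x) → comp y = comp x ∘ τ → π y = π x) (v : S) :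
    ∑ x, π x * (comp x (τ v) : ℝ) = ∑ x, π x * (comp x v : ℝ) := by
  classical
  choose f hf using symmState_exists hsurj hhub hsum τ
  have hfinj : Function.Injective f := fun x x' h => symmState_unique hinj τ (hf x) (h ▸ hf x')
  have hfbij : Function.Bijective f := Finite.injective_iff_bijective.mp hfinj
  calc ∑ x, π x * (comp x (τ v) : ℝ) = ∑ x, π (f x) * (comp (f x) v : ℝ) :=
        sum_congr rfl fun x _ => by rw [hπτ x (f x) (hf x).1 (hf x).2, (hf x).2]; rfl
    _ = ∑ y, π y * (comp y v : ℝ) := Equiv.sum_comp (Equiv.ofBijective f hfbij) (fun y => π y * (comp y v : ℝ))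

omit [DecidableEq X] [DecidableEq S] in
/-- **`E_{π_S}N(u) ≤ (K+1)/|O|`** when every `v ∈ O` is carried to `u` by a content symmetry preserving `μ_0` and `W` (X5's `π_S`; `W, μ_0 > 0`). [ours] -/
theorem lumpedStar_piS_expect_count_le_orbit [Nonempty X] (hinj : ∀ x x', hub x = hub x' → comp x = comp x' → x = x')
    (hsurj : ∀ (z : S) (N : S → ℕ), ∑ v, N v = K + 1 → N z ≠ 0 → ∃ x, hub x = z ∧ comp x = N) (hhub : ∀ x, comp x (hub x) ≠ 0)
    (hsum : ∀ x, ∑ v, comp x v = K + 1) (hW : ∀ v, 0 < W v) (hμpos : ∀ v, 0 < μ0 v)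
    (hg : ∀ N, g N = ∏ v, (μ0 v * W v) ^ (N v) / ((N v).factorial : ℝ))
    (hZ : Z = ∑ x, g (comp x) * ((comp x (hub x) : ℝ) / W (hub x))) (hπS : ∀ x, πS x = g (comp x) * ((comp x (hub x) : ℝ) / W (hub x)) / Z)
    (u : S) (O : Finset S) (hOne : O.Nonempty) (hO : ∀ v ∈ O, ∃ τ : S ≃ S, (∀ w, μ0 (τ w) = μ0 w) ∧ (∀ w, W (τ w) = W w) ∧ τ v = u) :
    ∑ x, πS x * (comp x u : ℝ) ≤ ((K : ℝ) + 1) / O.card := by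
  classical
  have hπ := lumpedStar_piS_pos hhub hW hμpos hg hZ hπS
  have hπ1 := lumpedStar_piS_sum hhub hW hμpos hg hZ hπS
  -- equal means along the orbit
  have heq : ∀ v ∈ O, ∑ x, πS x * (comp x v : ℝ) = ∑ x, πS x * (comp x u : ℝ) := by
    intro v hv
    obtain ⟨τ, hμτ, hWτ, hτv⟩ := hO v hv
    rw [← hτv]
    exact (expect_comp_symm hinj hsurj hhub hsum τ (fun x y h1 h2 => lumpedStar_piS_symm hg hπS τ hμτ hWτ ⟨h1, h2⟩) v).symm
  -- the total count is `K+1`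
  have htot : ∑ v, ∑ x, πS x * (comp x v : ℝ) = (K : ℝ) + 1 := by
    rw [sum_comm]
    calc ∑ x, ∑ v, πS x * (comp x v : ℝ) = ∑ x, πS x * ((K : ℝ) + 1) := sum_congr rfl fun x _ => by
          rw [← mul_sum]; congr 1; exact_mod_cast hsum x
      _ = (K : ℝ) + 1 := by rw [← sum_mul, hπ1, one_mul]
  have hOle : ∑ v ∈ O, ∑ x, πS x * (comp x v : ℝ) ≤ ∑ v, ∑ x, πS x * (comp x v : ℝ) :=
    sum_le_sum_of_subset_of_nonneg (subset_univ _) fun v _ _ => sum_nonneg fun x _ => mul_nonneg (hπ x).le (Nat.cast_nonneg _)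
  rw [sum_congr rfl heq, sum_const, nsmul_eq_mul, htot] at hOle
  have hOpos : (0 : ℝ) < O.card := Nat.cast_pos.mpr hOne.card_pos
  rw [le_div_iff₀ hOpos, mul_comm]; exact hOle

/-! ## §2 The coupon-collector floor on symmetric content types -/

/-- **THE ORBIT FORM OF THE COUPON-COLLECTOR FLOOR:** `u` in an orbit `O` (every `v ∈ O` carried to `u` by a symmetry preserving `μ_0`, `W`), `0 < σ < 1`, `K ≥ 2`,
`acc(·,u) ≤ a ∈ (0,1]` off `u`: **`t_mix^{steps}(1/4) ≥ (K/(σa) − 1)·log(K·|O|/(3(K+1+2|O|)))`**. [ours] -/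
theorem lumpedStar_step_mixingTime_ge_collector_orbit [Nonempty X] (hinj : ∀ x x', hub x = hub x' → comp x = comp x' → x = x')
    (hsurj : ∀ (z : S) (N : S → ℕ), ∑ v, N v = K + 1 → N z ≠ 0 → ∃ x, hub x = z ∧ comp x = N) (hhub : ∀ x, comp x (hub x) ≠ 0)
    (hsum : ∀ x, ∑ v, comp x v = K + 1) (hK : 2 ≤ K) (hW : ∀ v, 0 < W v) (hacc : ∀ h v, acc h v = min 1 (W h / W v)) (hμ1 : ∑ v, μ0 v = 1) (hμpos : ∀ v, 0 < μ0 v)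
    (hσ0 : 0 < σ) (hσ1 : σ < 1)
    (hKoff : ∀ N h v, h ≠ v → Kh N h v = if N h = 0 then 0 else (N v : ℝ) / K * acc h v) (hKdiag : ∀ N h, Kh N h h = 1 - ∑ v ∈ univ.erase h, Kh N h v)
    (hA : ∀ x x', Ast x x' = if comp x' = comp x then Kh (comp x) (hub x) (hub x') else 0)
    (hB : ∀ x x', Bst x x' = μ0 (hub x') * (if comp x' + Pi.single (hub x) 1 = comp x + Pi.single (hub x') 1 then 1 else 0))
    (hS : ∀ x x', Sst x x' = σ * Ast x x' + (1 - σ) * Bst x x')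
    (hg : ∀ N, g N = ∏ v, (μ0 v * W v) ^ (N v) / ((N v).factorial : ℝ))
    (hZ : Z = ∑ x, g (comp x) * ((comp x (hub x) : ℝ) / W (hub x))) (hπS : ∀ x, πS x = g (comp x) * ((comp x (hub x) : ℝ) / W (hub x)) / Z)
    (u : S) {a : ℝ} (ha0 : 0 < a) (ha1 : a ≤ 1) (ha : ∀ h, h ≠ u → acc h u ≤ a)
    (O : Finset S) (hOne : O.Nonempty) (hO : ∀ v ∈ O, ∃ τ : S ≃ S, (∀ w, μ0 (τ w) = μ0 w) ∧ (∀ w, W (τ w) = W w) ∧ τ v = u) :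
    ((K : ℝ) / (σ * a) - 1) * Real.log ((K : ℝ) * O.card / (3 * ((K : ℝ) + 1 + 2 * O.card))) ≤ (mixingTime Sst πS (1 / 4) : ℝ) := by
  have he := lumpedStar_piS_expect_count_le_orbit hinj hsurj hhub hsum hW hμpos hg hZ hπS u O hOne hO
  have h := lumpedStar_step_mixingTime_ge_collector_piS hinj hsurj hhub hsum hK hW hacc hμ1 hμpos hσ0 hσ1 hKoff hKdiag hA hB hS hg hZ hπS u ha0 ha1 ha he
  have hOpos : (0 : ℝ) < O.card := Nat.cast_pos.mpr hOne.card_pos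
  have e : (K : ℝ) / (3 * (((K : ℝ) + 1) / O.card + 2)) = (K : ℝ) * O.card / (3 * ((K : ℝ) + 1 + 2 * O.card)) := by
    field_simp
  rw [e] at h
  exact h

/-- **MANY EXCHANGEABLE CONTENTS:** if the orbit of `u` has `|O| ≥ K+1` then **`t_mix^{steps}(1/4) ≥ (K/(σa) − 1)·log(K/9)`**. [ours] -/
theorem lumpedStar_step_mixingTime_ge_collector_manyContents [Nonempty X] (hinj : ∀ x x', hub x = hub x' → comp x = comp x' → x = x')
    (hsurj : ∀ (z : S) (N : S → ℕ), ∑ v, N v = K + 1 → N z ≠ 0 → ∃ x, hub x = z ∧ comp x = N) (hhub : ∀ x, comp x (hub x) ≠ 0)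
    (hsum : ∀ x, ∑ v, comp x v = K + 1) (hK : 2 ≤ K) (hW : ∀ v, 0 < W v) (hacc : ∀ h v, acc h v = min 1 (W h / W v)) (hμ1 : ∑ v, μ0 v = 1) (hμpos : ∀ v, 0 < μ0 v)
    (hσ0 : 0 < σ) (hσ1 : σ < 1)
    (hKoff : ∀ N h v, h ≠ v → Kh N h v = if N h = 0 then 0 else (N v : ℝ) / K * acc h v) (hKdiag : ∀ N h, Kh N h h = 1 - ∑ v ∈ univ.erase h, Kh N h v)
    (hA : ∀ x x', Ast x x' = if comp x' = comp x then Kh (comp x) (hub x) (hub x') else 0)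
    (hB : ∀ x x', Bst x x' = μ0 (hub x') * (if comp x' + Pi.single (hub x) 1 = comp x + Pi.single (hub x') 1 then 1 else 0))
    (hS : ∀ x x', Sst x x' = σ * Ast x x' + (1 - σ) * Bst x x')
    (hg : ∀ N, g N = ∏ v, (μ0 v * W v) ^ (N v) / ((N v).factorial : ℝ))
    (hZ : Z = ∑ x, g (comp x) * ((comp x (hub x) : ℝ) / W (hub x))) (hπS : ∀ x, πS x = g (comp x) * ((comp x (hub x) : ℝ) / W (hub x)) / Z)
    (u : S) {a : ℝ} (ha0 : 0 < a) (ha1 : a ≤ 1) (ha : ∀ h, h ≠ u → acc h u ≤ a)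
    (O : Finset S) (hOK : K + 1 ≤ O.card) (hO : ∀ v ∈ O, ∃ τ : S ≃ S, (∀ w, μ0 (τ w) = μ0 w) ∧ (∀ w, W (τ w) = W w) ∧ τ v = u) :
    ((K : ℝ) / (σ * a) - 1) * Real.log ((K : ℝ) / 9) ≤ (mixingTime Sst πS (1 / 4) : ℝ) := by
  have hOne : O.Nonempty := card_pos.mp (by omega)
  have h := lumpedStar_step_mixingTime_ge_collector_orbit hinj hsurj hhub hsum hK hW hacc hμ1 hμpos hσ0 hσ1 hKoff hKdiag hA hB hS hg hZ hπS u ha0 ha1 ha O hOne hO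
  refine le_trans ?_ h
  have hKpos : (0 : ℝ) < K := by exact_mod_cast (by omega : 0 < K)
  have hOK' : (K : ℝ) + 1 ≤ O.card := by exact_mod_cast hOK
  have hσa : σ * a ≤ 1 := by nlinarith
  have hcoef : 0 ≤ (K : ℝ) / (σ * a) - 1 := by
    rw [sub_nonneg, le_div_iff₀ (mul_pos hσ0 ha0)]
    have : (2 : ℝ) ≤ K := by exact_mod_cast hK
    linarith
  refine mul_le_mul_of_nonneg_left (Real.log_le_log (by positivity) ?_) hcoef
  -- `K/9 ≤ K|O|/(3(K+1+2|O|))` iff `K+1 ≤ |O|`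
  rw [div_le_div_iff₀ (by norm_num) (by positivity)]
  nlinarith

/-- **TWO FLOORS FOR A TRANSITIVE SYMMETRIC CONTENT TYPE** (with chapter AD file 7): if every content is carried to `u` by a symmetry preserving `μ_0` and `W`, some symmetry moves `u`,
and `|S| ≥ K+1`, then **`t_mix^{steps}(1/4) ≥ (K+1)/(8(1−σ))`** and **`t_mix^{steps}(1/4) ≥ (K/σ − 1)·log(K/9)`** (`0 < σ < 1`, `K ≥ 2`). [ours] -/
theorem lumpedStar_step_mixingTime_two_floors [Nonempty X] (hinj : ∀ x x', hub x = hub x' → comp x = comp x' → x = x')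
    (hsurj : ∀ (z : S) (N : S → ℕ), ∑ v, N v = K + 1 → N z ≠ 0 → ∃ x, hub x = z ∧ comp x = N) (hhub : ∀ x, comp x (hub x) ≠ 0)
    (hsum : ∀ x, ∑ v, comp x v = K + 1) (hK : 2 ≤ K) (hW : ∀ v, 0 < W v) (hacc : ∀ h v, acc h v = min 1 (W h / W v)) (hμ1 : ∑ v, μ0 v = 1) (hμpos : ∀ v, 0 < μ0 v)
    (hσ0 : 0 < σ) (hσ1 : σ < 1)
    (hKoff : ∀ N h v, h ≠ v → Kh N h v = if N h = 0 then 0 else (N v : ℝ) / K * acc h v) (hKdiag : ∀ N h, Kh N h h = 1 - ∑ v ∈ univ.erase h, Kh N h v)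
    (hA : ∀ x x', Ast x x' = if comp x' = comp x then Kh (comp x) (hub x) (hub x') else 0)
    (hB : ∀ x x', Bst x x' = μ0 (hub x') * (if comp x' + Pi.single (hub x) 1 = comp x + Pi.single (hub x') 1 then 1 else 0))
    (hS : ∀ x x', Sst x x' = σ * Ast x x' + (1 - σ) * Bst x x')
    (hg : ∀ N, g N = ∏ v, (μ0 v * W v) ^ (N v) / ((N v).factorial : ℝ))
    (hZ : Z = ∑ x, g (comp x) * ((comp x (hub x) : ℝ) / W (hub x))) (hπS : ∀ x, πS x = g (comp x) * ((comp x (hub x) : ℝ) / W (hub x)) / Z)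
    (u : S) (hcard : K + 1 ≤ Fintype.card S) (htrans : ∀ v : S, ∃ τ : S ≃ S, (∀ w, μ0 (τ w) = μ0 w) ∧ (∀ w, W (τ w) = W w) ∧ τ v = u)
    (τ₀ : S ≃ S) (hμτ₀ : ∀ w, μ0 (τ₀ w) = μ0 w) (hWτ₀ : ∀ w, W (τ₀ w) = W w) (hu : τ₀ u ≠ u) :
    ((K : ℝ) + 1) / (8 * (1 - σ)) ≤ (mixingTime Sst πS (1 / 4) : ℝ) ∧ ((K : ℝ) / σ - 1) * Real.log ((K : ℝ) / 9) ≤ (mixingTime Sst πS (1 / 4) : ℝ) := by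
  have hK1 : 1 ≤ K := by omega
  refine ⟨(lumpedStar_step_mixingTime_ge_symmetric hinj hsurj hhub hsum hK1 hW hacc hμ1 hμpos hσ0 hσ1 hKoff hKdiag hA hB hS hg hZ hπS τ₀ hμτ₀ hWτ₀ hu).1, ?_⟩
  have ha : ∀ h, h ≠ u → acc h u ≤ 1 := fun h _ => by rw [hacc]; exact min_le_left _ _
  have h := lumpedStar_step_mixingTime_ge_collector_manyContents hinj hsurj hhub hsum hK hW hacc hμ1 hμpos hσ0 hσ1 hKoff hKdiag hA hB hS hg hZ hπS u one_pos le_rfl ha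
    (univ : Finset S) (by rw [card_univ]; exact hcard) (fun v _ => htrans v)
  rw [mul_one] at h
  exact h

end CollectorSymm

end Summit.Ventures.LatticeQCDFlow.Scaling

end
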